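import Literature.NumberTheory.EllipticCurves.FormalGroupKummerPointProofs
import HarnessLib

/-!
# `d` independent Kummer points of `E₁` over a ramified layer (input (C2_d) of the rank-`d`
# local skeleton of Greenberg's Lemma 3.4 at the layers `n ≥ 1`)

`Proofs` file (theorems only: **no definition, no named fact, nothing asserted**) in topic
`NumberTheory/EllipticCurves`, sequel of `FormalGroupKummerPointProofs` (which supplies ONE Kummer
point `u₁`, `z(u₁) = p²`, for the base layer: hypothesis (C2) of
`ResKernel.finite_primary_subgroupResKer_of_reduction`, Greenberg's Lemma 3.4 at `n = 0` over `ℚ`,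
R. Greenberg, *Iwasawa theory for elliptic curves*, LNM 1716 (1999), §3 Lemma 3.4, p. 89). At a
layer `n ≥ 1` of the cyclotomic tower the base field `M = (ℚ_n)_p` is totally ramified of degree
`d = pⁿ` over `ℚ_p`, `Ê(𝔪_M) ≅ ℤ_p^d` up to finite index (Greenberg, §2, proof of Prop. 2.2, p. 73:
"`E(M) ⊗ ℚ_p/ℤ_p` has `ℤ_p`-corank `[M : ℚ_p]`"), and the rank-`d` skeleton
(`ResKernel.finite_primary_subgroupResKer_of_stableSubgroup_rank`,
`WeierstrassCurve.finite_localTowerKerPrimary_of_ordinary_of_rank_inputs`) asks for input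
**(C2_d)**: `d` points `u₀, …, u_{d-1} ∈ E₁(K̄_v)` fixed by the open subgroup `H ≤ Γ_{K_v}` of the
layer, such that `∑ nᵢ uᵢ = p^m a` with `a` fixed by `H` forces `p^m ∣ c₁ nᵢ` for every `i`.
**This file proves (C2_d)** from two elementary data of the layer, with NO completed layer field:

* a `w`-UNIFORMISER-LIKE element `π ∈ K̄_v` fixed by `H` with `|π|^d = |p|` (for the cyclotomic
  layer over `ℚ`: `π = N_{ℚ_p(ζ_{p^{n+1}})/(ℚ_n)_p}(1 - ζ_{p^{n+1}})`, `d = pⁿ`), and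
* a UNIFORM BOUND `ρ < 1` on `|z(Q)|` over the `H`-fixed points `Q` of `E₁(K̄_v)` (the valuation of
  the fixed field of `H` is discrete; at `n = 0` the tree's `val_zCoord_le_of_forall_smul_eq` gives
  `ρ = |p|`),
together with the hypothesis of the one-point theorem (`N₀` multiplies every `H`-fixed point into
`E₁`). The points are `uᵢ ∈ E₁(K̄_v)` with `z(uᵢ) = p² πⁱ` (`exists_mem_kernel_zCoord_eq`, Hensel),
`0 ≤ i < d`; they are `H`-fixed, and:

* `val_zCoord_add_eq_max_of_ne`, `mem_kernel_sum_and_val_zCoord_sum_eq_sup` — **`z` of a sum of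
  points of `E₁` with pairwise distinct non-zero `|z|` has `|z| = max`** (translations of `E₁` are
  `z`-isometries, `val_zCoord_add_sub_eq`);
* `val_zCoord_pow_smul_le_pow` — **iterated multiplication by `p` contracts `E₁` geometrically**:
  `|z(p^j Q)| ≤ θ^{j+1}` for `|z(Q)| ≤ θ`, `|p| ≤ θ ≤ 1` (`|z(pR) - p z(R)| ≤ |z(R)|²`), so a FIXED
  power `p^J` (depending on `ρ`, `|p|` only) moves every `H`-fixed point of `E₁` into
  `E₂ = {|z| < |p|}`, where `|z(n Q)| = |n| |z(Q)|` (`val_zCoord_nsmul_eq`);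
* (private) `spectralValuation_natCast_eq_pow` — `|N|_v = |p|^{v_p(N)}` on `K̄_v`;
* `exists_kummerPoints_rank` — **(C2_d)** with `c₁ = p^{J+2} N₀`: in `∑ (c nᵢ) uᵢ = p^m Q'`
  (`Q' ∈ E₂`) the left side has `|z| = maxᵢ |c nᵢ| |p|² |π|ⁱ` (the values `|p|^{k+2+i/d}` are
  pairwise distinct for distinct `i < d`), the right side has `|z| = |p|^m |z(Q')| < |p|^{m+1}`, so
  `|c nᵢ| |p|³ < |p|^{m+1}` and `p^m ∣ p · c nᵢ` for every `i`.

HONEST FRAMING (cell `bsd-f1-sign2`, WIDTH-5 attach seat `bsd-line-att-p5` g41 on crux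
stmt-BirchSwinnertonDyer-22298, lineage successor (i) "Lemma 3.4 at the layer `n = 1` for
`p = 2`"): this discharges input (C2ₙ) of `finite_localTowerKerPrimary_of_ordinary_of_rank_inputs`
modulo the two displayed layer data (`π`, `ρ`); the cocycle count (C1ₙ) over the ramified layer
stays OPEN. Closes no item; BSD is not proved by any of this.

## References

* [SilvermanAEC2009] J. H. Silverman, *AEC*, 2nd ed. (2009), IV.1, IV.3.2, IV.6.4, VII.2.1–2.2.
* [GreenbergLNM1716] R. Greenberg, LNM 1716 (1999), §2 Prop. 2.2 (p. 73), §3 Lemma 3.4 (p. 89).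

## Design

No definitions, no named facts; `noncomputable section`; one universe `u`; the transport
`((W ⊗ K_v) ⊗ K̄_v).Point ≃+ E(K̄_v)` of `exists_kummerPoint` is reproduced verbatim. Fixedness by
`H` is phrased `∀ σ ∈ H, σ • x = x` (for the subgroup-type action of the skeleton use
`Subgroup.smul_def`). Axioms: `propext`, `Classical.choice`, `Quot.sound`.
-/

noncomputable section

open scoped Classical NNReal
open NumberField IsDedekindDomain

universe u

/-! ## §1 Formal-group level calculus: sums with distinct levels, geometric contraction by `p` -/

namespace Literature.NumberTheory.EllipticCurves.FormalGroupChart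

variable {F : Type u} [Field F] {w : Valuation F ℝ≥0} {V : WeierstrassCurve F}
  [hV : V.IsIntegral w.integer]

/-- **`|z(P + Q)| = |z(P)|` when `|z(Q)| < |z(P)|`** on `E₁`: translation by `Q` moves `z` by
exactly `|z(Q)|` (`val_zCoord_add_sub_eq`). Silverman, *AEC*, IV.1 / Prop. VII.2.2.
[cite: SilvermanAEC2009, Prop. VII.2.2] -/
theorem val_zCoord_add_eq_left_of_lt {P Q : V.toAffine.Point} (hP : P ∈ kernel w V)
    (hQ : Q ∈ kernel w V) (hlt : w Q.zCoord < w P.zCoord) :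
    w (P + Q).zCoord = w P.zCoord := by
  have h := val_zCoord_add_sub_eq hP hQ
  rw [← h] at hlt
  have key := Valuation.map_add_eq_of_lt_left w hlt
  rwa [add_sub_cancel] at key

/-- **`|z(P + Q)| = max(|z(P)|, |z(Q)|)` when `|z(P)| ≠ |z(Q)|`** on `E₁`. Silverman, *AEC*, IV.1 /
Prop. VII.2.2. [cite: SilvermanAEC2009, Prop. VII.2.2] -/
theorem val_zCoord_add_eq_max_of_ne {P Q : V.toAffine.Point} (hP : P ∈ kernel w V)
    (hQ : Q ∈ kernel w V) (hne : w P.zCoord ≠ w Q.zCoord) :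
    w (P + Q).zCoord = max (w P.zCoord) (w Q.zCoord) := by
  rcases lt_or_gt_of_ne hne with h | h
  · rw [max_eq_right h.le, add_comm]
    exact val_zCoord_add_eq_left_of_lt hQ hP h
  · rw [max_eq_left h.le]
    exact val_zCoord_add_eq_left_of_lt hP hQ h

/-- **A sum of points of `E₁` whose non-zero levels `|z|` are pairwise distinct has
`|z(∑ Pᵢ)| = maxᵢ |z(Pᵢ)|`** (and lies in `E₁`). Induction on the finite index set with
`val_zCoord_add_eq_max_of_ne`; a summand with `z = 0` is `O` (`zCoord_eq_zero_iff`).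
Silverman, *AEC*, IV.1 / Prop. VII.2.2. [cite: SilvermanAEC2009, Prop. VII.2.2] -/
theorem mem_kernel_sum_and_val_zCoord_sum_eq_sup {ι : Type*} (s : Finset ι)
    (P : ι → V.toAffine.Point) (hP : ∀ i ∈ s, P i ∈ kernel w V)
    (hne : ∀ i ∈ s, ∀ j ∈ s, i ≠ j → w (P i).zCoord = w (P j).zCoord → w (P i).zCoord = 0) :
    (∑ i ∈ s, P i) ∈ kernel w V ∧ w (∑ i ∈ s, P i).zCoord = s.sup fun i ↦ w (P i).zCoord := by
  classical
  induction s using Finset.induction_on with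
  | empty =>
    rw [Finset.sum_empty, Finset.sup_empty, WeierstrassCurve.Affine.Point.zCoord_zero, map_zero]
    exact ⟨(kernel w V).zero_mem, rfl⟩
  | insert a s ha ih =>
    obtain ⟨hmem, hval⟩ := ih (fun i hi ↦ hP i (Finset.mem_insert_of_mem hi))
      (fun i hi j hj ↦ hne i (Finset.mem_insert_of_mem hi) j (Finset.mem_insert_of_mem hj))
    have hPa : P a ∈ kernel w V := hP a (Finset.mem_insert_self a s)
    rw [Finset.sum_insert ha, Finset.sup_insert]
    refine ⟨(kernel w V).add_mem hPa hmem, ?_⟩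
    by_cases h0 : w (P a).zCoord = 0
    · -- `P a = O`
      have hPa0 : P a = 0 :=
        (zCoord_eq_zero_iff hPa).mp ((Valuation.zero_iff w).mp h0)
      rw [hPa0, zero_add, hval, WeierstrassCurve.Affine.Point.zCoord_zero, map_zero]
      exact (bot_sup_eq _).symm
    by_cases h1 : w (∑ i ∈ s, P i).zCoord = 0
    · -- the tail is `O`
      have hs0 : ∑ i ∈ s, P i = 0 :=
        (zCoord_eq_zero_iff hmem).mp ((Valuation.zero_iff w).mp h1)
      rw [hs0, add_zero, ← hval, h1]
      exact (sup_bot_eq _).symm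
    -- both levels non-zero: they differ
    have hsne : s.Nonempty := by
      by_contra hs
      rw [Finset.not_nonempty_iff_eq_empty] at hs
      rw [hs, Finset.sum_empty, WeierstrassCurve.Affine.Point.zCoord_zero, map_zero] at h1
      exact h1 rfl
    obtain ⟨j, hj, hjsup⟩ := Finset.exists_mem_eq_sup s hsne fun i ↦ w (P i).zCoord
    have hdiff : w (P a).zCoord ≠ w (∑ i ∈ s, P i).zCoord := by
      intro h
      have haj : a ≠ j := fun e ↦ ha (e ▸ hj)
      rw [hval, hjsup] at h
      exact h0 (hne a (Finset.mem_insert_self a s) j (Finset.mem_insert_of_mem hj) haj h)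
    rw [val_zCoord_add_eq_max_of_ne hPa hmem hdiff, hval]

/-- **Multiplication by `p` contracts `E₁` geometrically**: if `|z(Q)| ≤ θ` with `|p| ≤ θ ≤ 1`,
then `|z(p^j Q)| ≤ θ^{j+1}` for every `j` (`|z(pR) - p z(R)| ≤ |z(R)|²`, `val_zCoord_nsmul`, so
`|z(pR)| ≤ max(|p| |z(R)|, |z(R)|²)`). Silverman, *AEC*, IV.3.2 / VII.2.2.
[cite: SilvermanAEC2009, Prop. VII.2.2] -/
theorem val_zCoord_pow_smul_le_pow (p : ℕ) {θ : ℝ≥0} (hpθ : w (p : F) ≤ θ) (hθ1 : θ ≤ 1)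
    {Q : V.toAffine.Point} (hQ : Q ∈ kernel w V) (hQθ : w Q.zCoord ≤ θ) (j : ℕ) :
    p ^ j • Q ∈ kernel w V ∧ w (p ^ j • Q).zCoord ≤ θ ^ (j + 1) := by
  induction j with
  | zero => rw [pow_zero, one_smul, zero_add, pow_one]; exact ⟨hQ, hQθ⟩
  | succ j ih =>
    obtain ⟨hR, hRθ⟩ := ih
    obtain ⟨hpR, -, hest⟩ := val_zCoord_nsmul (w := w) (V := V) p hR
    rw [pow_succ', mul_smul]
    refine ⟨hpR, ?_⟩
    have e : (p • (p ^ j • Q)).zCoord =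
        ((p • (p ^ j • Q)).zCoord - (p : F) * (p ^ j • Q).zCoord) + (p : F) * (p ^ j • Q).zCoord := by
      ring
    rw [e]
    refine (Valuation.map_add w _ _).trans (max_le (hest.trans ?_) ?_)
    · calc w (p ^ j • Q).zCoord ^ 2 ≤ (θ ^ (j + 1)) ^ 2 := pow_le_pow_left' hRθ 2
        _ = θ ^ (2 * j + 2) := by rw [← pow_mul]; ring_nf
        _ ≤ θ ^ (j + 1 + 1) := pow_le_pow_of_le_one zero_le hθ1 (by omega)
    · rw [map_mul, pow_succ, mul_comm]
      exact mul_le_mul' hRθ hpθ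

end Literature.NumberTheory.EllipticCurves.FormalGroupChart

/-! ## §2 `|N|_v = |p|^{v_p(N)}` -/

namespace IsDedekindDomain.HeightOneSpectrum

open Literature.NumberTheory.EllipticCurves Literature.NumberTheory.EllipticCurves.FormalGroupChart
  Literature.NumberTheory.GaloisRepresentations Field _root_.WeierstrassCurve

variable {K : Type u} [Field K] [NumberField K] {v : HeightOneSpectrum (𝓞 K)}
  {p : ℕ} [hp : Fact p.Prime] (hpv : (p : 𝓞 K) ∈ v.asIdeal)
  {w : Valuation (AlgebraicClosure (v.adicCompletion K)) ℝ≥0}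
  (hw : ∀ x, (w x : ℝ) = spectralNorm (v.adicCompletion K) (AlgebraicClosure (v.adicCompletion K)) x)

include hpv hw in
/-- **`|N|_v = |p|_v^{v_p(N)}`** on `K̄_v` (`v ∣ p`, `N ≠ 0`): write `N = p^j N'`, `p ∤ N'`, `|N'| = 1`.
[folklore] -/
private theorem spectralValuation_natCast_eq_pow {N : ℕ} (hN : N ≠ 0) :
    w (N : AlgebraicClosure (v.adicCompletion K)) =
      w (p : AlgebraicClosure (v.adicCompletion K)) ^ padicValNat p N := by
  obtain ⟨j, N', hN', rfl⟩ := Nat.exists_eq_pow_mul_and_not_dvd hN p hp.out.ne_one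
  have hN'0 : N' ≠ 0 := by rintro rfl; exact hN' (dvd_zero p)
  rw [Nat.cast_mul, Nat.cast_pow, map_mul, map_pow,
    spectralValuation_natCast_eq_one_of_not_dvd hpv hw hN', mul_one,
    padicValNat.mul (pow_ne_zero j hp.out.ne_zero) hN'0,
    padicValNat.prime_pow, padicValNat.eq_zero_of_not_dvd hN', add_zero]

/-! ## §3 The `d` Kummer points and input (C2_d) -/

include hpv hw in
set_option maxHeartbeats 1600000 in
/-- **`d` independent Kummer points of `E₁(K̄_v)` over a ramified layer (input (C2_d) of the
rank-`d` local skeleton).** Let `v ∣ p`, `E/K` elliptic with `w`-integral coefficients over `K̄_v`,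
`H ≤ Γ_{K_v}` a subgroup, `N₀ ≥ 1` multiplying every `H`-fixed point of `E(K̄_v)` into the kernel
of reduction `E₁`, `ρ < 1` a bound for `|z|` on the `H`-fixed points of `E₁`, and `π ∈ K̄_v` fixed
by `H` with `|π|^d = |p|`, `d ≥ 1`. Then there are `H`-fixed points `u₀, …, u_{d-1} ∈ E₁(K̄_v)`
(`z(uᵢ) = p² πⁱ`, Hensel) and `c₁ ≥ 1` such that `∑ᵢ nᵢ uᵢ = p^m a` with `a` fixed by `H` implies
`p^m ∣ c₁ nᵢ` for every `i`: with `p^J` moving every `H`-fixed point of `E₁` into `E₂`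
(`val_zCoord_pow_smul_le_pow`) and `c = p^J N₀`, the point `∑ (c nᵢ) uᵢ = p^m (p^J N₀ a)` has
`|z| = maxᵢ |c nᵢ| |p|² |π|ⁱ` (pairwise distinct levels, `mem_kernel_sum_and_val_zCoord_sum_eq_sup`)
and `|z| = |p|^m |z(p^J N₀ a)| < |p|^{m+1}` (`val_zCoord_nsmul_eq`), whence `|p c nᵢ| ≤ |p|^m`
(`pow_dvd_of_spectralValuation_natCast_le`). For `d = 1`, `π = p⁰`-free, this is the tree's
`exists_kummerPoint`. Silverman, *AEC*, VII.2.2, IV.6.4; Greenberg, LNM 1716, §2 Prop. 2.2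
(`Ê(𝔪_M) ⊗ ℚ_p/ℤ_p` has corank `[M : ℚ_p]`), §3 Lemma 3.4.
[cite: SilvermanAEC2009, Prop. VII.2.2] [cite: GreenbergLNM1716, §2 Prop. 2.2 (p. 73)] -/
theorem exists_kummerPoints_rank (W : WeierstrassCurve K) [W.IsElliptic]
    [hV : (W.baseChange (AlgebraicClosure (v.adicCompletion K))).IsIntegral w.integer]
    (H : Subgroup (absoluteGaloisGroup (v.adicCompletion K)))
    {N₀ : ℕ} (hN₀ : 0 < N₀)
    (hN₀E₁ : ∀ a : localPoints W (v.adicCompletion K), (∀ σ ∈ H, σ • a = a) →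
      ((N₀ • a : localPoints W (v.adicCompletion K)) :
        (W.baseChange (AlgebraicClosure (v.adicCompletion K))).toAffine.Point) ∈
        kernel w (W.baseChange (AlgebraicClosure (v.adicCompletion K))))
    {ρ : ℝ≥0} (hρ : ρ < 1)
    (hU : ∀ a : localPoints W (v.adicCompletion K), (∀ σ ∈ H, σ • a = a) →
      (a : (W.baseChange (AlgebraicClosure (v.adicCompletion K))).toAffine.Point) ∈
        kernel w (W.baseChange (AlgebraicClosure (v.adicCompletion K))) →
      w (a : (W.baseChange (AlgebraicClosure (v.adicCompletion K))).toAffine.Point).zCoord ≤ ρ)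
    {d : ℕ} (hd : 0 < d) {π : AlgebraicClosure (v.adicCompletion K)}
    (hπH : ∀ σ ∈ H, σ • π = π)
    (hπ : w π ^ d = w (p : AlgebraicClosure (v.adicCompletion K))) :
    ∃ (u : Fin d → localPoints W (v.adicCompletion K)) (c₁ : ℕ), 0 < c₁ ∧
      (∀ i, ∀ σ ∈ H, σ • u i = u i) ∧
      (∀ i, (u i : (W.baseChange (AlgebraicClosure (v.adicCompletion K))).toAffine.Point) ∈
        kernel w (W.baseChange (AlgebraicClosure (v.adicCompletion K)))) ∧
      ∀ (m : ℕ) (n : Fin d → ℤ) (a : localPoints W (v.adicCompletion K)),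
        (∀ σ ∈ H, σ • a = a) → ∑ i, n i • u i = p ^ m • a →
          ∀ i, ((p ^ m : ℕ) : ℤ) ∣ (c₁ : ℤ) * n i := by
  haveI : CharZero (AlgebraicClosure (v.adicCompletion K)) :=
    charZero_of_injective_algebraMap (algebraMap K _).injective
  have hp0 : 0 < w (p : (AlgebraicClosure (v.adicCompletion K))) := by rw [Valuation.pos_iff]; exact Nat.cast_ne_zero.mpr hp.out.ne_zero
  have hp1 : w (p : (AlgebraicClosure (v.adicCompletion K))) < 1 := by
    have h := spectralValuation_algebraMap_ringOfIntegers_lt_one (v := v) hw hpv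
    rwa [map_natCast] at h
  have hunit : ∀ n : ℕ, ¬ p ∣ n → w (n : (AlgebraicClosure (v.adicCompletion K))) = 1 := fun n hn ↦
    spectralValuation_natCast_eq_one_of_not_dvd hpv hw hn
  -- `|π| < 1`, `|π| ≤ 1`
  have hπ1 : w π < 1 := by
    by_contra h
    rw [not_lt] at h
    have : (1 : ℝ≥0) ≤ w π ^ d := one_le_pow₀ h
    rw [hπ] at this
    exact absurd hp1 (not_lt.mpr this)
  have hπ1' : w π ≤ 1 := hπ1.le
  -- the curve `(W ⊗ K_v) ⊗ K̄_v = W ⊗ K̄_v` and the transport of points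
  have hbb : (W.baseChange (v.adicCompletion K)).baseChange (AlgebraicClosure (v.adicCompletion K)) = W.baseChange (AlgebraicClosure (v.adicCompletion K)) :=
    (W.map_baseChange (IsScalarTower.toAlgHom K (v.adicCompletion K) (AlgebraicClosure (v.adicCompletion K))) : _)
  haveI hV' : ((W.baseChange (v.adicCompletion K)).baseChange (AlgebraicClosure (v.adicCompletion K))).IsIntegral w.integer := by
    rw [hbb]; exact hV
  set T : ((W.baseChange (v.adicCompletion K)).baseChange (AlgebraicClosure (v.adicCompletion K))).toAffine.Point ≃+
      localPoints W (v.adicCompletion K) := Affine.Point.congrEquiv hbb with hTdef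
  have hTsome : ∀ x y h, ∃ h', T (.some x y h) = .some x y h' := fun x y h ↦
    ⟨_, Affine.Point.congrEquiv_some hbb h⟩
  have hTz : ∀ Q : ((W.baseChange (v.adicCompletion K)).baseChange (AlgebraicClosure (v.adicCompletion K))).toAffine.Point,
      ((T Q : localPoints W (v.adicCompletion K)) : (W.baseChange (AlgebraicClosure (v.adicCompletion K))).toAffine.Point).zCoord =
        Q.zCoord := by
    intro Q
    rcases Q with _ | ⟨x, y, h⟩
    · rw [← WeierstrassCurve.Affine.Point.zero_def, map_zero]; rfl
    · obtain ⟨h', e⟩ := hTsome x y h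
      rw [e]; rfl
  have hTker : ∀ Q : ((W.baseChange (v.adicCompletion K)).baseChange (AlgebraicClosure (v.adicCompletion K))).toAffine.Point,
      Q ∈ kernel w ((W.baseChange (v.adicCompletion K)).baseChange (AlgebraicClosure (v.adicCompletion K))) →
      ((T Q : localPoints W (v.adicCompletion K)) : (W.baseChange (AlgebraicClosure (v.adicCompletion K))).toAffine.Point) ∈
        kernel w (W.baseChange (AlgebraicClosure (v.adicCompletion K))) := by
    intro Q hQ
    rcases Q with _ | ⟨x, y, h⟩
    · rw [← WeierstrassCurve.Affine.Point.zero_def, map_zero]; exact (kernel w _).zero_mem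
    · obtain ⟨h', e⟩ := hTsome x y h
      rw [e]
      exact some_mem_kernel (w := w) h' ((some_mem_kernel_iff (w := w) h).mp hQ)
  have hTsmul : ∀ (σ : absoluteGaloisGroup (v.adicCompletion K))
      (Q : ((W.baseChange (v.adicCompletion K)).baseChange (AlgebraicClosure (v.adicCompletion K))).toAffine.Point),
      σ • (T Q : localPoints W (v.adicCompletion K)) =
        T (Affine.Point.map (show (AlgebraicClosure (v.adicCompletion K)) ≃ₐ[v.adicCompletion K] (AlgebraicClosure (v.adicCompletion K)) from σ : (AlgebraicClosure (v.adicCompletion K)) →ₐ[v.adicCompletion K] (AlgebraicClosure (v.adicCompletion K))) Q) := by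
    intro σ Q
    rcases Q with _ | ⟨x, y, h⟩
    · rw [← WeierstrassCurve.Affine.Point.zero_def, Affine.Point.map_zero, map_zero]
      exact smul_zero σ
    · obtain ⟨h', e⟩ := hTsome x y h
      rw [e, Affine.Point.map_some, localPoints.smul_def, Affine.Point.map_some]
      obtain ⟨h'', e'⟩ := hTsome _ _ ((WeierstrassCurve.Affine.baseChange_nonsingular
        (W := (W.baseChange (v.adicCompletion K)).toAffine)
        (show (AlgebraicClosure (v.adicCompletion K)) ≃ₐ[v.adicCompletion K] (AlgebraicClosure (v.adicCompletion K)) from σ : (AlgebraicClosure (v.adicCompletion K)) →ₐ[v.adicCompletion K] (AlgebraicClosure (v.adicCompletion K))).injective ..).mpr h)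
      rw [e']
      rfl
  -- the Hensel points with `z = p² πⁱ`
  have hzlt : ∀ i : Fin d, w ((p : (AlgebraicClosure (v.adicCompletion K))) ^ 2 * π ^ (i : ℕ)) < 1 := fun i ↦ by
    rw [map_mul, map_pow, map_pow]
    exact mul_lt_one_of_nonneg_of_lt_one_left zero_le (pow_lt_one₀ zero_le hp1 two_ne_zero)
      (pow_le_one₀ zero_le hπ1')
  have hP : ∀ i : Fin d, ∃ P ∈ kernel w ((W.baseChange (v.adicCompletion K)).baseChange (AlgebraicClosure (v.adicCompletion K))),
      P.zCoord = (p : (AlgebraicClosure (v.adicCompletion K))) ^ 2 * π ^ (i : ℕ) ∧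
      ∀ σ : (AlgebraicClosure (v.adicCompletion K)) ≃ₐ[v.adicCompletion K] (AlgebraicClosure (v.adicCompletion K)), (∀ z, w (σ z) = w z) → σ ((p : (AlgebraicClosure (v.adicCompletion K))) ^ 2 * π ^ (i : ℕ)) =
        (p : (AlgebraicClosure (v.adicCompletion K))) ^ 2 * π ^ (i : ℕ) → Affine.Point.map (σ : (AlgebraicClosure (v.adicCompletion K)) →ₐ[v.adicCompletion K] (AlgebraicClosure (v.adicCompletion K))) P = P :=
    fun i ↦ exists_mem_kernel_zCoord_eq (w := w) (W.baseChange (v.adicCompletion K)) (hzlt i)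
  choose P hPker hPz hPfix using hP
  -- the uniform power `p^J` into `E₂`
  set θ : ℝ≥0 := max (w (p : (AlgebraicClosure (v.adicCompletion K)))) ρ with hθ
  have hθ1 : θ < 1 := max_lt hp1 hρ
  obtain ⟨J, hJ⟩ := exists_pow_lt_of_lt_one hp0 hθ1
  -- `c₁ = p · (p^J N₀) · p`… : we take `c₁ = p ^ (J + 2) * N₀`
  refine ⟨fun i ↦ T (P i), p ^ (J + 2) * N₀, Nat.mul_pos (pow_pos hp.out.pos _) hN₀,
    fun i σ _hσ ↦ ?_, fun i ↦ hTker _ (hPker i), fun m n a hafix hrel i₀ ↦ ?_⟩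
  · -- `H`-fixed: `σ` is an isometry fixing `p² πⁱ`
    have hσπ : (show (AlgebraicClosure (v.adicCompletion K)) ≃ₐ[v.adicCompletion K]
        (AlgebraicClosure (v.adicCompletion K)) from σ) π = π := hπH σ _hσ
    rw [hTsmul, hPfix i σ (fun z ↦ spectralValuation_smul hw σ z) (by
      rw [map_mul, map_pow, map_pow, map_natCast, hσπ])]
  · -- (C2_d)
    set u : Fin d → localPoints W (v.adicCompletion K) := fun i ↦ T (P i) with hu
    have huker : ∀ i, ((u i : localPoints W (v.adicCompletion K)) : (W.baseChange (AlgebraicClosure (v.adicCompletion K))).toAffine.Point) ∈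
        kernel w (W.baseChange (AlgebraicClosure (v.adicCompletion K))) := fun i ↦ hTker _ (hPker i)
    have huz : ∀ i, w ((u i : localPoints W (v.adicCompletion K)) :
        (W.baseChange (AlgebraicClosure (v.adicCompletion K))).toAffine.Point).zCoord = w (p : (AlgebraicClosure (v.adicCompletion K))) ^ 2 * w π ^ (i : ℕ) := fun i ↦ by
      rw [hu, hTz, hPz, map_mul, map_pow, map_pow]
    have huzlt : ∀ i, w ((u i : localPoints W (v.adicCompletion K)) :
        (W.baseChange (AlgebraicClosure (v.adicCompletion K))).toAffine.Point).zCoord < w (p : (AlgebraicClosure (v.adicCompletion K))) := fun i ↦ by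
      rw [huz, sq, mul_assoc]
      exact mul_lt_of_lt_one_right hp0 (mul_lt_one_of_nonneg_of_lt_one_left zero_le hp1
        (pow_le_one₀ zero_le hπ1'))
    -- `Q = N₀ a ∈ E₁`, `H`-fixed, `|z(Q)| ≤ ρ ≤ θ`; `Q' = p^J Q ∈ E₂`
    set Q : (W.baseChange (AlgebraicClosure (v.adicCompletion K))).toAffine.Point :=
      ((N₀ • a : localPoints W (v.adicCompletion K)) : (W.baseChange (AlgebraicClosure (v.adicCompletion K))).toAffine.Point) with hQdef
    have hQker : Q ∈ kernel w (W.baseChange (AlgebraicClosure (v.adicCompletion K))) := hN₀E₁ a hafix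
    have hQfix : ∀ σ ∈ H, σ • (N₀ • a) = N₀ • a := fun σ hσ ↦ by rw [smul_comm, hafix σ hσ]
    have hzQ : w Q.zCoord ≤ θ := (hU (N₀ • a) hQfix hQker).trans (le_max_right _ _)
    obtain ⟨hQ'ker, hzQ'⟩ := val_zCoord_pow_smul_le_pow (w := w) (V := W.baseChange (AlgebraicClosure (v.adicCompletion K))) p
      (le_max_left _ _) hθ1.le hQker hzQ J
    have hzQ'lt : w (p ^ J • Q).zCoord < w (p : (AlgebraicClosure (v.adicCompletion K))) :=
      lt_of_le_of_lt (hzQ'.trans (pow_le_pow_of_le_one zero_le hθ1.le (Nat.le_succ J))) hJ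
    -- the scalar `c = p^J N₀` and the relation `∑ (c nᵢ) uᵢ = p^m Q'`
    set c : ℕ := p ^ J * N₀ with hc
    have hc0 : c ≠ 0 := Nat.mul_ne_zero (pow_ne_zero J hp.out.ne_zero) hN₀.ne'
    have hrel' : (∑ i, ((c : ℤ) * n i) • u i : localPoints W (v.adicCompletion K)) =
        p ^ m • (p ^ J • (N₀ • a)) := by
      have e1 : (∑ i, ((c : ℤ) * n i) • u i : localPoints W (v.adicCompletion K)) =
          (c : ℤ) • ∑ i, n i • u i := by
        rw [Finset.smul_sum]
        exact Finset.sum_congr rfl fun i _ ↦ mul_smul _ _ _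
      rw [e1, hrel, natCast_zsmul, hc, smul_comm, mul_smul]
    -- levels of the summands
    let R : Fin d → (W.baseChange (AlgebraicClosure (v.adicCompletion K))).toAffine.Point := fun i ↦
      ((((c : ℤ) * n i) • u i : localPoints W (v.adicCompletion K)) : (W.baseChange (AlgebraicClosure (v.adicCompletion K))).toAffine.Point)
    have hRker : ∀ i, R i ∈ kernel w (W.baseChange (AlgebraicClosure (v.adicCompletion K))) := fun i ↦
      (kernel w (W.baseChange (AlgebraicClosure (v.adicCompletion K)))).zsmul_mem (huker i) _
    have hRz : ∀ i, w (R i).zCoord =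
        w ((((c : ℤ) * n i).natAbs : ℕ) : (AlgebraicClosure (v.adicCompletion K))) *
          (w (p : (AlgebraicClosure (v.adicCompletion K))) ^ 2 * w π ^ (i : ℕ)) := by
      intro i
      by_cases hz : (c : ℤ) * n i = 0
      · have e2 : R i = 0 := by
          change (((c : ℤ) * n i) • u i : localPoints W (v.adicCompletion K)) = 0
          rw [hz, zero_smul]
        rw [e2, hz, Int.natAbs_zero, Nat.cast_zero, map_zero, zero_mul]
        exact map_zero w
      have hz' : ((c : ℤ) * n i).natAbs ≠ 0 := Int.natAbs_ne_zero.mpr hz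
      have h1 := val_zCoord_nsmul_eq (w := w) (V := W.baseChange (AlgebraicClosure (v.adicCompletion K)))
        hp.out hunit _ hz' (huker i) (huzlt i)
      rcases Int.natAbs_eq ((c : ℤ) * n i) with he | he
      · have e2 : (((c : ℤ) * n i) • u i : localPoints W (v.adicCompletion K)) =
            (((c : ℤ) * n i).natAbs : ℕ) • u i := by
          conv_lhs => rw [he]
          exact natCast_zsmul _ _
        rw [← huz i, ← h1]
        exact congrArg (fun S : localPoints W (v.adicCompletion K) ↦
          w (S : (W.baseChange (AlgebraicClosure (v.adicCompletion K))).toAffine.Point).zCoord) e2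
      · have e2 : (((c : ℤ) * n i) • u i : localPoints W (v.adicCompletion K)) =
            -((((c : ℤ) * n i).natAbs : ℕ) • u i) := by
          conv_lhs => rw [he]
          rw [neg_smul, natCast_zsmul]
        have h2 := val_zCoord_neg (w := w) (V := W.baseChange (AlgebraicClosure (v.adicCompletion K)))
          ((kernel w (W.baseChange (AlgebraicClosure (v.adicCompletion K)))).nsmul_mem (huker i)
            ((c : ℤ) * n i).natAbs)
        rw [← huz i, ← h1, ← h2]
        exact congrArg (fun S : localPoints W (v.adicCompletion K) ↦
          w (S : (W.baseChange (AlgebraicClosure (v.adicCompletion K))).toAffine.Point).zCoord) e2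
    -- the non-zero levels are pairwise distinct
    have hinj : ∀ (k k' : ℕ) (i j : Fin d),
        w (p : (AlgebraicClosure (v.adicCompletion K))) ^ k * (w (p : (AlgebraicClosure (v.adicCompletion K))) ^ 2 * w π ^ (i : ℕ)) =
          w (p : (AlgebraicClosure (v.adicCompletion K))) ^ k' * (w (p : (AlgebraicClosure (v.adicCompletion K))) ^ 2 * w π ^ (j : ℕ)) → i = j := by
      intro k k' i j h
      have h' : (w (p : (AlgebraicClosure (v.adicCompletion K))) ^ k * (w (p : (AlgebraicClosure (v.adicCompletion K))) ^ 2 * w π ^ (i : ℕ))) ^ d =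
          (w (p : (AlgebraicClosure (v.adicCompletion K))) ^ k' * (w (p : (AlgebraicClosure (v.adicCompletion K))) ^ 2 * w π ^ (j : ℕ))) ^ d := by rw [h]
      have e : ∀ (k : ℕ) (i : ℕ), (w (p : (AlgebraicClosure (v.adicCompletion K))) ^ k *
          (w (p : (AlgebraicClosure (v.adicCompletion K))) ^ 2 * w π ^ i)) ^ d =
          w (p : (AlgebraicClosure (v.adicCompletion K))) ^ (d * (k + 2) + i) := fun k i ↦ by
        calc (w (p : (AlgebraicClosure (v.adicCompletion K))) ^ k *
              (w (p : (AlgebraicClosure (v.adicCompletion K))) ^ 2 * w π ^ i)) ^ d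
            = (w (p : (AlgebraicClosure (v.adicCompletion K))) ^ k) ^ d *
                ((w (p : (AlgebraicClosure (v.adicCompletion K))) ^ 2) ^ d * (w π ^ i) ^ d) := by
              rw [mul_pow, mul_pow]
          _ = (w (p : (AlgebraicClosure (v.adicCompletion K))) ^ k) ^ d *
                ((w (p : (AlgebraicClosure (v.adicCompletion K))) ^ 2) ^ d * (w π ^ d) ^ i) := by
              rw [← pow_mul (w π), mul_comm i d, pow_mul]
          _ = w (p : (AlgebraicClosure (v.adicCompletion K))) ^ (d * (k + 2) + i) := by
              rw [hπ, ← pow_mul, ← pow_mul, ← pow_add, ← pow_add]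
              congr 1
              ring
      rw [e, e] at h'
      have hexp := (pow_right_strictAnti₀ hp0 hp1).injective h'
      have hi := i.2
      have hj := j.2
      apply Fin.ext
      -- `d (k+2) + i = d (k'+2) + j` with `i, j < d` forces `i = j`
      have h1 : (d * (k + 2) + (i : ℕ)) % d = (d * (k' + 2) + (j : ℕ)) % d := by rw [hexp]
      rwa [Nat.mul_add_mod, Nat.mul_add_mod, Nat.mod_eq_of_lt hi, Nat.mod_eq_of_lt hj] at h1
    have hne : ∀ i ∈ (Finset.univ : Finset (Fin d)), ∀ j ∈ (Finset.univ : Finset (Fin d)),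
        i ≠ j → w (R i).zCoord = w (R j).zCoord → w (R i).zCoord = 0 := by
      intro i _ j _ hij h
      by_contra hRi
      rw [hRz i, hRz j] at h
      have hni : ((c : ℤ) * n i).natAbs ≠ 0 := fun hz ↦ hRi (by
        rw [hRz i, hz, Nat.cast_zero, map_zero, zero_mul])
      have hnj : ((c : ℤ) * n j).natAbs ≠ 0 := by
        intro hz
        rw [hz, Nat.cast_zero, map_zero, zero_mul, mul_eq_zero] at h
        rcases h with h | h
        · exact hni (by
            have := (Valuation.zero_iff w).mp h
            exact_mod_cast this)
        · exact absurd h (ne_of_gt (mul_pos (pow_pos hp0 2) (pow_pos ((Valuation.pos_iff w).mpr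
            (fun hπ0 ↦ by rw [hπ0, map_zero, zero_pow hd.ne'] at hπ; exact hp0.ne' hπ.symm)) _)))
      rw [spectralValuation_natCast_eq_pow hpv hw hni, spectralValuation_natCast_eq_pow hpv hw hnj] at h
      exact hij (hinj _ _ i j h)
    obtain ⟨-, hsum⟩ := mem_kernel_sum_and_val_zCoord_sum_eq_sup (w := w) (V := W.baseChange (AlgebraicClosure (v.adicCompletion K)))
      Finset.univ R (fun i _ ↦ hRker i) hne
    -- the relation in `(W ⊗ K̄_v).Point`
    have hsumR : (∑ i, R i) = p ^ m • (p ^ J • Q) := by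
      change ((∑ i, ((c : ℤ) * n i) • u i : localPoints W (v.adicCompletion K)) :
        (W.baseChange (AlgebraicClosure (v.adicCompletion K))).toAffine.Point) = _
      rw [hrel']
      rfl
    -- upper bound: `|z(∑)| = |p|^m |z(Q')| < |p|^{m+1}`
    have hup : w (∑ i, R i).zCoord < w (p : (AlgebraicClosure (v.adicCompletion K))) ^ m * w (p : (AlgebraicClosure (v.adicCompletion K))) := by
      rw [hsumR, val_zCoord_nsmul_eq (w := w) (V := W.baseChange (AlgebraicClosure (v.adicCompletion K))) hp.out hunit (p ^ m)
        (pow_ne_zero m hp.out.ne_zero) hQ'ker hzQ'lt, Nat.cast_pow, map_pow]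
      exact mul_lt_mul_of_pos_left hzQ'lt (pow_pos hp0 m)
    -- lower bound at `i₀`: `|z(R i₀)| ≤ |z(∑)|`
    have hlow : w (R i₀).zCoord ≤ w (∑ i, R i).zCoord := by
      rw [hsum]
      exact Finset.le_sup (f := fun i ↦ w (R i).zCoord) (Finset.mem_univ i₀)
    -- conclude `p^m ∣ p^{J+2} N₀ nᵢ₀`
    by_cases hn0 : n i₀ = 0
    · rw [hn0, mul_zero]; exact dvd_zero _
    have hcn : ((c : ℤ) * n i₀).natAbs ≠ 0 := by
      rw [ne_eq, Int.natAbs_eq_zero, mul_eq_zero, not_or]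
      exact ⟨by exact_mod_cast hc0, hn0⟩
    have hkey : w ((((c : ℤ) * n i₀).natAbs : ℕ) : (AlgebraicClosure (v.adicCompletion K))) * (w (p : (AlgebraicClosure (v.adicCompletion K))) ^ 2 * w π ^ (i₀ : ℕ)) <
        w (p : (AlgebraicClosure (v.adicCompletion K))) ^ m * w (p : (AlgebraicClosure (v.adicCompletion K))) := by rw [← hRz i₀]; exact lt_of_le_of_lt hlow hup
    -- `|π|^{i₀} ≥ |π|^d = |p|`
    have hπi : w (p : (AlgebraicClosure (v.adicCompletion K))) ≤ w π ^ (i₀ : ℕ) := by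
      rw [← hπ]; exact pow_le_pow_of_le_one zero_le hπ1' i₀.2.le
    have hkey' : w ((((c : ℤ) * n i₀).natAbs : ℕ) : (AlgebraicClosure (v.adicCompletion K))) * w (p : (AlgebraicClosure (v.adicCompletion K))) ^ 3 <
        w (p : (AlgebraicClosure (v.adicCompletion K))) ^ m * w (p : (AlgebraicClosure (v.adicCompletion K))) := by
      refine lt_of_le_of_lt ?_ hkey
      rw [pow_succ]
      exact mul_le_mul' le_rfl (mul_le_mul' le_rfl hπi)
    rw [spectralValuation_natCast_eq_pow hpv hw hcn, ← pow_add, ← pow_succ] at hkey'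
    have hlt := (pow_lt_pow_iff_right_of_lt_one₀ hp0 hp1).mp hkey'
    -- `m + 1 < v_p(c n) + 3`, i.e. `m ≤ v_p(c n) + 1 = v_p(p c n)`
    have hdvdN : p ^ m ∣ p * ((c : ℤ) * n i₀).natAbs := by
      have h1 : p ^ (padicValNat p ((c : ℤ) * n i₀).natAbs) ∣ ((c : ℤ) * n i₀).natAbs :=
        pow_padicValNat_dvd
      have h2 : p ^ m ∣ p ^ (padicValNat p ((c : ℤ) * n i₀).natAbs + 1) :=
        pow_dvd_pow p (by omega)
      rw [pow_succ'] at h2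
      exact h2.trans (mul_dvd_mul_left p h1)
    have hZ : ((p ^ m : ℕ) : ℤ) ∣ (p : ℤ) * ((c : ℤ) * n i₀) := by
      rw [← Int.dvd_natAbs, Int.natAbs_mul, Int.natAbs_natCast]
      exact Int.natCast_dvd_natCast.mpr hdvdN
    -- `p^{J+2} N₀ nᵢ₀ = p · (p · c · nᵢ₀)`
    have e : ((p ^ (J + 2) * N₀ : ℕ) : ℤ) * n i₀ = (p : ℤ) * ((p : ℤ) * ((c : ℤ) * n i₀)) := by
      simp only [hc]; push_cast; ring
    rw [e]
    exact hZ.trans (dvd_mul_left _ _)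

end IsDedekindDomain.HeightOneSpectrum
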